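import Literature.AlgebraicGeometry.Limits.LocalizationRelativeSchemeSpread
import Literature.AlgebraicGeometry.Limits.LocalizationRelativeSmoothSpread
import Literature.AlgebraicGeometry.Limits.LocalizationStageRelativeDimensionSpread
import Literature.AlgebraicGeometry.Limits.LocalizationRelativeProperSpread
import Literature.AlgebraicGeometry.Limits.LocalizationRelativeGeomConnectedSpread
import Literature.AlgebraicGeometry.Limits.LocalizationRelativeGroupSpreadDock
import Literature.AlgebraicGeometry.AbelianSchemes.AbelianSchemeOverBase
import HarnessLib

/-!
# An abelian scheme over `P ×_A Spec K` comes from an abelian scheme over a stage `P ×_A Spec A[1/t]`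
# (EGA IV₃ 8.8.2 (ii), 8.10.5 (xii), IV₄ 17.7.8 RELATIVE to a qc∕qs proper base `P` of finite presentation; MFK Def. 7.2)

Topic `Literature/AlgebraicGeometry/AbelianSchemes`; namespaces `Literature.AlgebraicGeometry.Limits.LocApprox` (§1 plumbing) and
`Literature.AlgebraicGeometry.AbelianSchemes.AbelianSchemeOver` (§2).  THEOREMS ONLY (no definition, no named fact, no instance, no notation,
no `sorry`; net Literature debt 0).  Cell `hodgecm-mathlib` (D-0151), programme F0∕P6 «MOD», SPREAD door (LEAD M-17m), organ **(SP1-e) = the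
ASSEMBLY of the census «abelian-scheme spread over a LocApprox stage»** (LEAD F0P6-plan (g2) 2026-09-01 20:42:56Z; pen A-p06 (g31)) over the
organs (a) ★ `Limits/LocalizationRelativeSchemeSpread` (A-p06), (b) ★ `Limits/LocalizationRelativeSmoothSpread` (A-p14 (g33)), (c) ★
`Limits/LocalizationRelativeProperSpread` (B-p18 (g37)), (d) ★ `Limits/GroupLawTransferAlong` + `Limits/LocalizationRelativeGroupSpread` + `Limits/LocalizationRelativeGroupSpreadDock` (A-p01 (g25)), (f) ★
`Limits/LocalizationRelativeGeomConnectedSpread` (A-p14 (g33)), (g) ★ `Limits/LocalizationStageRelativeDimensionSpread` (A-p06);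
`--supports stmt-HodgeConjecture-24832`, count-neutral.  HONEST LABEL: HC_CM is proved only modulo the 2 remaining named inputs (hLiu418 24832,
h413 24833) until rung 0 closes; this file discharges none of them.

## Statement

`A` a Noetherian domain with fraction field `K`, `Spec K = lim_t D(t)` over the basic open stages `D(t) = Spec A[1/t]`, `t ∈ A ∖ {0}` (★
`LocalizationDiagram`, `S = nonZeroDivisors A`), `P → Spec A` quasi-compact, quasi-separated, locally of finite presentation and PROPER (the
consumer: a smooth projective curve model over a ring of `S`-integers).  **`AbelianSchemeOver.exists_stage_of_generic`: every abelian scheme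
`𝒜` over `(P ⊗ Spec K).left` is, for some stage `t`, the base change of an abelian scheme `𝒜ₜ` over `(P ⊗ D(t)).left` along the leg
`(P ◁ leg_t).left : (P ⊗ Spec K).left → (P ⊗ D(t)).left`**, in the sense of [MumfordFogartyKirwan1994] Def. 7.2 (★ `IsBaseChangeVia`: a
cartesian square of total spaces compatible with the identity sections and the group laws); `exists_stage_of_generic_of_isOfRelDim` adds «of
relative dimension `g`» (the `hg` input of ★ SP2 `LevelStructure.exists_stage_of_generic`).  Universe 0 in §2 (organ (f) rests on ★
`Morphisms/SmoothConnectedFibreLocusRepresents`, stated for `Scheme.{0}`).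

## Proof (the chain; each step at a finer stage, each property riding the later restrictions)

0. generic flatness (★ `exists_forall_flat_snd`): a stage below which `P ⊗ D(t) → D(t)` is flat (needed by (d), whose transfer of the
   group axioms at a FIXED stage uses the schematic density of `P ⊗ Spec K` in `P ⊗ D(t)`);
1. (a) ★ `exists_stage_isPullback` (EGA IV₃ 8.8.2 (ii) relative to `P`): the total space `Y → (P ⊗ D(t)).left` with `𝒜.X = Y ×_{P ⊗ D(t)} (P ⊗ Spec K)`;
2. (b) ★ `exists_stage_smooth` (IV₄ 17.7.8): `Y|_{D(s)} → P ⊗ D(s)` smooth; 3. (c) ★ `exists_stage_isProper` (IV₃ 8.10.5 (xii), via the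
   total space and `P` proper); 4. (f) ★ `exists_stage_geometricallyConnected` (MFK Prop. 7.3 step (I) ∕ EGA IV₃ 12.2.4: the locus of
   geometrically connected fibres of a smooth proper morphism is open); [4′. (g) ★ `exists_stage_smoothOfRelativeDimension`;]
5. (d) ★ `exists_stage_grpObj_isPullback` (8.8.2 (i): the law, unit and inverse descend to a finer stage, the axioms holding there) — LAST,
   so that the group structure lands on the final object and `Smooth`∕`IsProper`∕`GeometricallyConnected`∕`Flat` ride its restriction square
   by `MorphismProperty.of_isPullback`.
§1 is the plumbing: `of_isPullback_of_isPullback` (two base changes of one morphism along one map share every iso-invariant property),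
`exists_isPullback_pullback_snd` (the restriction step keeps the cartesian square to the generic fibre), `flat_snd_baseDiagram_of_hom`.

## References

* [EGAIV3] A. Grothendieck, J. Dieudonné, EGA IV₃ (Publ. Math. IHÉS 28, 1966), Thm. 8.8.2, Thm. 8.10.5 (xii), Thm. 12.2.4.
* [EGAIV4] EGA IV₄ (Publ. Math. IHÉS 32, 1967), Prop. 17.7.8.
* [MumfordFogartyKirwan1994] D. Mumford, J. Fogarty, F. Kirwan, *Geometric Invariant Theory*, 3rd ed. (1994), Ch. 6 §1 Def. 6.1 (p. 115),
  Ch. 7 §2 Def. 7.2 (p. 129), Prop. 7.3 (pp. 132–134).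
* [GortzWedhorn2020] U. Görtz, T. Wedhorn, *Algebraic Geometry I: Schemes*, 2nd ed. (2020), Section (4.15) (p. 116), Thm. 10.57, Thm. 10.66.
-/

set_option autoImplicit false

noncomputable section

universe u

open CategoryTheory CategoryTheory.Limits AlgebraicGeometry MonoidalCategory CartesianMonoidalCategory
open scoped MonObj

namespace Literature.AlgebraicGeometry.Limits.LocApprox

open Literature.AlgebraicGeometry.Motives (SchemeOver specOver)

set_option backward.isDefEq.respectTransparency false


/-! ## §1 Plumbing: two base changes along the same map; the restriction step -/

section Plumbing

variable {A : Type u} [CommRing A] {S : Submonoid A} {B : Type u} [CommRing B] [Algebra A B] [IsLocalization S B]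
variable {P : SchemeOver A}

/-- **A morphism property which respects isomorphisms passes between two base changes of the same morphism along the same
map** (both are the pullback, canonically isomorphic over the base).  [cite: GortzWedhorn2020, Section (4.15) (p. 116)] -/
theorem of_isPullback_of_isPullback {W : MorphismProperty Scheme.{u}} [W.RespectsIso] {X₁ X₂ Y T T' : Scheme.{u}}
    {G₁ : X₁ ⟶ Y} {f₁ : X₁ ⟶ T'} {G₂ : X₂ ⟶ Y} {f₂ : X₂ ⟶ T'} {g : Y ⟶ T} {i : T' ⟶ T}
    (pb₁ : IsPullback G₁ f₁ g i) (pb₂ : IsPullback G₂ f₂ g i) (h : W f₁) : W f₂ := by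
  let e : X₁ ≅ X₂ := pb₁.isoPullback ≪≫ pb₂.isoPullback.symm
  have he : e.hom ≫ f₂ = f₁ := by
    simp only [e, Iso.trans_hom, Iso.symm_hom, Category.assoc, IsPullback.isoPullback_inv_snd,
      IsPullback.isoPullback_hom_snd]
  exact (W.arrow_mk_iso_iff (Arrow.isoMk e (Iso.refl T') (by exact (Category.comp_id f₁).symm ▸ he :))).mp h

/-- **The restriction step.**  If `X → P ⊗ Spec B` is the base change of `Y → P ⊗ D(t)` along the leg (`IsPullback G …`), then for a
finer stage `ρ : s ⟶ t` it is the base change of the restriction `Y|_{D(s)} = Y ×_{P ⊗ D(t)} (P ⊗ D(s)) → P ⊗ D(s)` along the leg at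
`s`, compatibly with `G` (transitivity of fibre products; `leg_s ≫ D(ρ) = leg_t`).  [cite: GortzWedhorn2020, Section (4.15) (p. 116)]
[cite: EGAIV3, Thm. 8.8.2, setting (8.8.1)] -/
theorem exists_isPullback_pullback_snd {t s : Idx S} (ρ : s ⟶ t) (X : Over (P ⊗ specOver A B).left)
    (Y : Over (P ⊗ (baseDiagram S).obj t).left) (G : X.left ⟶ Y.left) (pb : IsPullback G X.hom Y.hom (P ◁ leg S B t).left) :
    ∃ Gₛ : X.left ⟶ pullback Y.hom (P ◁ (baseDiagram S).map ρ).left,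
      Gₛ ≫ pullback.fst _ _ = G ∧
        IsPullback Gₛ X.hom (pullback.snd Y.hom (P ◁ (baseDiagram S).map ρ).left) (P ◁ leg S B s).left := by
  have hleg : (P ◁ leg S B s).left ≫ (P ◁ (baseDiagram S).map ρ).left = (P ◁ leg S B t).left := by
    rw [← Over.comp_left, ← MonoidalCategory.whiskerLeft_comp, leg_comp_map]
  have w : G ≫ Y.hom = (X.hom ≫ (P ◁ leg S B s).left) ≫ (P ◁ (baseDiagram S).map ρ).left := by
    rw [Category.assoc, hleg]; exact pb.w
  refine ⟨pullback.lift G (X.hom ≫ (P ◁ leg S B s).left) w, pullback.lift_fst _ _ _, ?_⟩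
  refine IsPullback.of_right ?_ (pullback.lift_snd _ _ _)
    (IsPullback.of_hasPullback Y.hom (P ◁ (baseDiagram S).map ρ).left)
  rw [pullback.lift_fst, hleg]
  exact pb

/-- **Stage-flatness of `P` passes to finer stages**: `P ⊗ D(s) → D(s)` is the base change of `P ⊗ D(t) → D(t)` along `D(s) → D(t)`.
[cite: GortzWedhorn2020, Section (4.15) (p. 116)] -/
theorem flat_snd_baseDiagram_of_hom {t s : Idx S} (ρ : s ⟶ t) (h : Flat (pullback.snd P.hom ((baseDiagram S).obj t).hom)) :
    Flat (pullback.snd P.hom ((baseDiagram S).obj s).hom) :=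
  MorphismProperty.of_isPullback (SubalgApprox.isPullback_whiskerLeft_left P ((baseDiagram S).map ρ)) h

end Plumbing

end Literature.AlgebraicGeometry.Limits.LocApprox

/-! ## §2 The assembly -/

namespace Literature.AlgebraicGeometry.AbelianSchemes

namespace AbelianSchemeOver

open Literature.AlgebraicGeometry.Motives (SchemeOver specOver)
open Literature.AlgebraicGeometry.Limits Literature.AlgebraicGeometry.Limits.LocApprox

set_option backward.isDefEq.respectTransparency false

-- UNIVERSE 0: organ (f) rests on ★ `Morphisms/SmoothConnectedFibreLocusRepresents` (`Scheme.{0}`); the consumer is universe 0.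
variable {A : Type} [CommRing A] [IsDomain A] [IsNoetherianRing A] {K : Type} [Field K] [Algebra A K] [IsFractionRing A K]
variable {P : SchemeOver A} [QuasiCompact P.hom] [QuasiSeparated P.hom] [LocallyOfFinitePresentation P.hom] [IsProper P.hom]

/-- **The total space, smoothness, properness and geometric connectedness of the fibres come from a stage.**  For an abelian scheme
`𝒜` over `P ⊗ Spec K` (`P` quasi-compact, quasi-separated, of finite presentation and PROPER over the Noetherian domain `A`,
`K = Frac A`) there are a stage `t`, a quasi-compact quasi-separated `Y → (P ⊗ D(t)).left` locally of finite presentation which is smooth,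
proper and with geometrically connected fibres, and a cartesian square `G : 𝒜.X → Y` over the leg `P ⊗ Spec K → P ⊗ D(t)`: the total
space by (a) ★ `exists_stage_isPullback`, then smoothness (b), properness (c, `P` proper) and geometric connectedness (f) at successively
finer stages, each preserved by the later restrictions (§1).  [cite: EGAIV3, Thm. 8.8.2 (ii) and Thm. 8.10.5 (xii)]
[cite: EGAIV4, Prop. 17.7.8 (ii)] -/
theorem exists_stage_smooth_isProper_geometricallyConnected (𝒜 : AbelianSchemeOver (P ⊗ specOver A K).left) :
    ∃ (t : Idx (nonZeroDivisors A)) (Y : Over (P ⊗ (baseDiagram (nonZeroDivisors A)).obj t).left) (G : 𝒜.X.left ⟶ Y.left),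
      QuasiCompact Y.hom ∧ QuasiSeparated Y.hom ∧ LocallyOfFinitePresentation Y.hom ∧ Smooth Y.hom ∧ IsProper Y.hom ∧
        GeometricallyConnected Y.hom ∧ Flat (pullback.snd P.hom ((baseDiagram (nonZeroDivisors A)).obj t).hom) ∧
          IsPullback G 𝒜.X.hom Y.hom (P ◁ (baseCone (nonZeroDivisors A) K).π.app t).left := by
  haveI := 𝒜.isProper
  haveI := 𝒜.isSmooth
  haveI := 𝒜.geometricallyConnected
  -- generic flatness: `P ⊗ D(s_P) → D(s_P)` is flat for some stage `s_P`
  obtain ⟨sP, hsP, hflat⟩ := exists_forall_flat_snd P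
  have hflat₀ : Flat (pullback.snd P.hom ((baseDiagram (nonZeroDivisors A)).obj ⟨sP, hsP⟩).hom) :=
    hflat sP (dvd_refl sP) (loc (nonZeroDivisors A) ⟨sP, hsP⟩)
  -- (a) the total space comes from a stage; refine below `s_P`
  obtain ⟨t₀', Y₀', G₀', hqc', hqs', hlfp', pb₀'⟩ := exists_stage_isPullback (nonZeroDivisors A) 𝒜.X
  haveI := hqc'
  haveI := hqs'
  haveI := hlfp'
  obtain ⟨t₀, ⟨ρ₀⟩, ⟨ρP⟩⟩ := exists_hom₂ (nonZeroDivisors A) t₀' (⟨sP, hsP⟩ : Idx (nonZeroDivisors A))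
  have hflatP₀ : Flat (pullback.snd P.hom ((baseDiagram (nonZeroDivisors A)).obj t₀).hom) := flat_snd_baseDiagram_of_hom ρP hflat₀
  obtain ⟨G₀, -, pb₀⟩ := exists_isPullback_pullback_snd ρ₀ 𝒜.X Y₀' G₀' pb₀'
  let Y₀ : Over (P ⊗ (baseDiagram (nonZeroDivisors A)).obj t₀).left :=
    Over.mk (pullback.snd Y₀'.hom (P ◁ (baseDiagram (nonZeroDivisors A)).map ρ₀).left)
  haveI : QuasiCompact Y₀.hom := inferInstanceAs (QuasiCompact (pullback.snd _ _))
  haveI : QuasiSeparated Y₀.hom := inferInstanceAs (QuasiSeparated (pullback.snd _ _))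
  haveI : LocallyOfFinitePresentation Y₀.hom := inferInstanceAs (LocallyOfFinitePresentation (pullback.snd _ _))
  replace pb₀ : IsPullback G₀ 𝒜.X.hom Y₀.hom (P ◁ leg (nonZeroDivisors A) K t₀).left := pb₀
  -- (b) smooth at a finer stage
  have hsm₀ : Smooth (pullback.snd Y₀.hom (P ◁ leg (nonZeroDivisors A) K t₀).left) :=
    of_isPullback_of_isPullback pb₀ (IsPullback.of_hasPullback _ _) 𝒜.isSmooth
  obtain ⟨t₁, ρ₁, hsm₁⟩ := exists_stage_smooth (B := K) P Y₀ hsm₀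
  obtain ⟨G₁, -, pb₁⟩ := exists_isPullback_pullback_snd ρ₁ 𝒜.X Y₀ G₀ pb₀
  let Y₁ : Over (P ⊗ (baseDiagram (nonZeroDivisors A)).obj t₁).left :=
    Over.mk (pullback.snd Y₀.hom (P ◁ (baseDiagram (nonZeroDivisors A)).map ρ₁).left)
  haveI : Smooth Y₁.hom := hsm₁
  haveI : QuasiCompact Y₁.hom := inferInstanceAs (QuasiCompact (pullback.snd _ _))
  haveI : QuasiSeparated Y₁.hom := inferInstanceAs (QuasiSeparated (pullback.snd _ _))
  haveI : LocallyOfFinitePresentation Y₁.hom := inferInstanceAs (LocallyOfFinitePresentation (pullback.snd _ _))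
  replace pb₁ : IsPullback G₁ 𝒜.X.hom Y₁.hom (P ◁ leg (nonZeroDivisors A) K t₁).left := pb₁
  -- (c) proper at a finer stage (`P` proper over `A`)
  have hpr₁ : IsProper (pullback.snd Y₁.hom (P ◁ leg (nonZeroDivisors A) K t₁).left) :=
    of_isPullback_of_isPullback pb₁ (IsPullback.of_hasPullback _ _) 𝒜.isProper
  obtain ⟨t₂, ρ₂, hpr₂⟩ := exists_stage_isProper P Y₁ hpr₁
  obtain ⟨G₂, -, pb₂⟩ := exists_isPullback_pullback_snd ρ₂ 𝒜.X Y₁ G₁ pb₁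
  let Y₂ : Over (P ⊗ (baseDiagram (nonZeroDivisors A)).obj t₂).left :=
    Over.mk (pullback.snd Y₁.hom (P ◁ (baseDiagram (nonZeroDivisors A)).map ρ₂).left)
  haveI : IsProper Y₂.hom := hpr₂
  haveI : Smooth Y₂.hom := inferInstanceAs (Smooth (pullback.snd _ _))
  replace pb₂ : IsPullback G₂ 𝒜.X.hom Y₂.hom (P ◁ leg (nonZeroDivisors A) K t₂).left := pb₂
  -- (f) geometrically connected fibres at a finer stage
  have hgc₂ : GeometricallyConnected (pullback.snd Y₂.hom (P ◁ leg (nonZeroDivisors A) K t₂).left) :=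
    of_isPullback_of_isPullback pb₂ (IsPullback.of_hasPullback _ _) 𝒜.geometricallyConnected
  haveI := isLocallyNoetherian_tensorObj_baseDiagram_left P t₂
  obtain ⟨t₃, ρ₃, hgc₃⟩ := exists_stage_geometricallyConnected P Y₂ hgc₂
  obtain ⟨G₃, -, pb₃⟩ := exists_isPullback_pullback_snd ρ₃ 𝒜.X Y₂ G₂ pb₂
  refine ⟨t₃, Over.mk (pullback.snd Y₂.hom (P ◁ (baseDiagram (nonZeroDivisors A)).map ρ₃).left), G₃,
    inferInstanceAs (QuasiCompact (pullback.snd _ _)), inferInstanceAs (QuasiSeparated (pullback.snd _ _)),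
    inferInstanceAs (LocallyOfFinitePresentation (pullback.snd _ _)), inferInstanceAs (Smooth (pullback.snd _ _)),
    inferInstanceAs (IsProper (pullback.snd _ _)), hgc₃,
    flat_snd_baseDiagram_of_hom ρ₃ (flat_snd_baseDiagram_of_hom ρ₂ (flat_snd_baseDiagram_of_hom ρ₁ hflatP₀)), pb₃⟩

/-- **An abelian scheme over the generic fibre `P ⊗ Spec K` of a quasi-compact quasi-separated proper `A`-scheme `P` of finite
presentation (`A` a Noetherian domain, `K = Frac A`) is the base change of an abelian scheme over a stage `P ⊗ D(t)`**, in the sense of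
MFK Def. 7.2 (★ `IsBaseChangeVia`: cartesian square of total spaces compatible with unit and law).  Assembly of the SP1 organs: the
smooth proper stage model with geometrically connected fibres (`exists_stage_smooth_isProper_geometricallyConnected`), then the group
law descends to a finer stage compatibly (d), the three properties riding the last restriction.
[cite: EGAIV3, Thm. 8.8.2 (ii) and Thm. 8.10.5 (xii)] [cite: EGAIV4, Prop. 17.7.8 (ii)]
[cite: MumfordFogartyKirwan1994, Ch. 7 §2 Definition 7.2 (p. 129)] -/
theorem exists_stage_of_generic (𝒜 : AbelianSchemeOver (P ⊗ specOver A K).left) :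
    ∃ (t : Idx (nonZeroDivisors A)) (𝒜ₜ : AbelianSchemeOver (P ⊗ (baseDiagram (nonZeroDivisors A)).obj t).left)
      (G : 𝒜.X.left ⟶ 𝒜ₜ.X.left), 𝒜.IsBaseChangeVia 𝒜ₜ (P ◁ (baseCone (nonZeroDivisors A) K).π.app t).left G := by
  obtain ⟨t₃, Y₃, G₃, hqc, hqs, hlfp, hsm₃, hpr₃, hgc₃, hflat₃, pb₃⟩ := exists_stage_smooth_isProper_geometricallyConnected 𝒜
  haveI := hqc
  haveI := hqs
  haveI := hlfp
  haveI := hsm₃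
  haveI := hpr₃
  haveI := hflat₃
  -- (d) the group law at a finer stage, compatibly
  obtain ⟨t, ρ, Yₜ, _, G, R, w, hR, -, pb, hη, hμ⟩ := exists_stage_grpObj_isPullback 𝒜.X Y₃ G₃ pb₃
  have hsm : Smooth Yₜ.hom := MorphismProperty.of_isPullback hR hsm₃
  have hpr : IsProper Yₜ.hom := MorphismProperty.of_isPullback hR hpr₃
  have hgc : GeometricallyConnected Yₜ.hom := MorphismProperty.of_isPullback hR hgc₃
  exact ⟨t, ⟨Yₜ, hpr, hsm, hgc⟩, G, w, pb, hη, hμ⟩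

/-- **The same with the relative dimension** (MFK Def. 7.2 (i): «of dimension `g`»): if `𝒜` is of relative dimension `g` over
`P ⊗ Spec K`, the stage model may be taken of relative dimension `g` over `P ⊗ D(t)` (organ (g): the relative dimension of the smooth stage
model spreads from the generic fibre before the group law is descended, and rides the last restriction).  This is the `hg` input of ★ SP2
`LevelStructure.exists_stage_of_generic`.  [cite: EGAIV4, Prop. 17.7.8 (ii)] [cite: MumfordFogartyKirwan1994, Ch. 7 §2 Definition 7.2 (p. 129)] -/
theorem exists_stage_of_generic_of_isOfRelDim (𝒜 : AbelianSchemeOver (P ⊗ specOver A K).left) {g : ℕ} (hg : 𝒜.IsOfRelDim g) :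
    ∃ (t : Idx (nonZeroDivisors A)) (𝒜ₜ : AbelianSchemeOver (P ⊗ (baseDiagram (nonZeroDivisors A)).obj t).left)
      (G : 𝒜.X.left ⟶ 𝒜ₜ.X.left), 𝒜.IsBaseChangeVia 𝒜ₜ (P ◁ (baseCone (nonZeroDivisors A) K).π.app t).left G ∧ 𝒜ₜ.IsOfRelDim g := by
  obtain ⟨t₃, Y₃, G₃, hqc, hqs, hlfp, hsm₃, hpr₃, hgc₃, hflat₃, pb₃⟩ := exists_stage_smooth_isProper_geometricallyConnected 𝒜
  haveI := hqc
  haveI := hqs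
  haveI := hlfp
  haveI := hsm₃
  haveI := hpr₃
  haveI := hgc₃
  -- (g) relative dimension `g` at a finer stage
  haveI := smoothOfRelativeDimension_isStableUnderBaseChange (n := g)
  have hrd₃ : SmoothOfRelativeDimension g (pullback.snd Y₃.hom (P ◁ leg (nonZeroDivisors A) K t₃).left) :=
    of_isPullback_of_isPullback pb₃ (IsPullback.of_hasPullback _ _) ((𝒜.isOfRelDim_iff g).1 hg)
  obtain ⟨t₄, ρ₄, hrd₄⟩ := exists_stage_smoothOfRelativeDimension K P Y₃ g hrd₃
  obtain ⟨G₄, -, pb₄⟩ := exists_isPullback_pullback_snd ρ₄ 𝒜.X Y₃ G₃ pb₃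
  let Y₄ : Over (P ⊗ (baseDiagram (nonZeroDivisors A)).obj t₄).left :=
    Over.mk (pullback.snd Y₃.hom (P ◁ (baseDiagram (nonZeroDivisors A)).map ρ₄).left)
  haveI : QuasiCompact Y₄.hom := inferInstanceAs (QuasiCompact (pullback.snd _ _))
  haveI : QuasiSeparated Y₄.hom := inferInstanceAs (QuasiSeparated (pullback.snd _ _))
  haveI : LocallyOfFinitePresentation Y₄.hom := inferInstanceAs (LocallyOfFinitePresentation (pullback.snd _ _))
  have hsm₄ : Smooth Y₄.hom := inferInstanceAs (Smooth (pullback.snd _ _))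
  have hpr₄ : IsProper Y₄.hom := inferInstanceAs (IsProper (pullback.snd _ _))
  have hgc₄ : GeometricallyConnected Y₄.hom := inferInstanceAs (GeometricallyConnected (pullback.snd _ _))
  replace hrd₄ : SmoothOfRelativeDimension g Y₄.hom := hrd₄
  replace pb₄ : IsPullback G₄ 𝒜.X.hom Y₄.hom (P ◁ leg (nonZeroDivisors A) K t₄).left := pb₄
  haveI : Flat (pullback.snd P.hom ((baseDiagram (nonZeroDivisors A)).obj t₄).hom) := flat_snd_baseDiagram_of_hom ρ₄ hflat₃
  -- (d) the group law at a finer stage, compatibly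
  obtain ⟨t, ρ, Yₜ, _, G, R, w, hR, -, pb, hη, hμ⟩ := exists_stage_grpObj_isPullback 𝒜.X Y₄ G₄ pb₄
  have hsm : Smooth Yₜ.hom := MorphismProperty.of_isPullback hR hsm₄
  have hpr : IsProper Yₜ.hom := MorphismProperty.of_isPullback hR hpr₄
  have hgc : GeometricallyConnected Yₜ.hom := MorphismProperty.of_isPullback hR hgc₄
  have hrd : SmoothOfRelativeDimension g Yₜ.hom := MorphismProperty.of_isPullback hR hrd₄
  exact ⟨t, ⟨Yₜ, hpr, hsm, hgc⟩, G, ⟨w, pb, hη, hμ⟩, (AbelianSchemeOver.isOfRelDim_iff _ g).2 hrd⟩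

end AbelianSchemeOver

end Literature.AlgebraicGeometry.AbelianSchemes

end
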